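import Mathlib

/-!
# `SnSubsetDichotomy.HyperoctahedralThreshold` — a poor host family, II: the fibre `(𝔽_p² ∖ 0)/±`

Support file for crux `stmt-MatrixMultiplication-10883` (line `refutation-local-symmetry`,
siege on `stub_poorRigidCore`); companion of `…PoorHostAlgebra` and `…PoorHostFamily`.

The fibre of the host family is `V0 p := (𝔽_p² ∖ {0}) / {±1}` (`p` prime), on which a matrix
`M ∈ SL₂(𝔽_p)` acts on the right through row vectors, `[v] ↦ [v ᵥ* M]` (`actV`).  Facts proved:
the action is well defined and multiplicative (`actV_actV`), `-1` acts trivially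
(`actV_neg_one`), a fixed point `[v] = [v ᵥ* M]` forces `tr M = ± 2` (`trace_of_actV_eq`, via
the `2 × 2` trace lemmas `trace_eq_two_of_vecMul_eq`, `trace_eq_neg_two_of_vecMul_eq_neg`), and the size bounds
`|V0 p| ≤ p²`, `p² ≤ 2 |V0 p| + 1`, `0 < |V0 p|`.  Design: a `Quotient` by an explicit `Setoid`
(scoped instance on the subtype of nonzero vectors), so that words act by plain matrix products
(`Matrix.vecMul_vecMul`).  Everything here is [folklore].
-/

namespace Summit.MatrixMultiplication.MatrixMultiplication.Theorems.HyperoctahedralThreshold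

namespace PoorHost

open Matrix

section Model

variable (p : ℕ) [Fact p.Prime]

/-- Nonzero vectors of `(ZMod p)²`. -/
abbrev NZ : Type := {v : Fin 2 → ZMod p // v ≠ 0}

/-- The relation `v ~ w ↔ w = v ∨ w = -v` on nonzero vectors (scoped instance). -/
scoped instance pmSetoid : Setoid (NZ p) where
  r v w := w.1 = v.1 ∨ w.1 = -v.1
  iseqv := by
    refine ⟨fun v => Or.inl rfl, ?_, ?_⟩
    · rintro v w (h | h)
      · exact Or.inl h.symm
      · exact Or.inr (by rw [h, neg_neg])
    · rintro u v w (h1 | h1) (h2 | h2)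
      · exact Or.inl (h2.trans h1)
      · exact Or.inr (by rw [h2, h1])
      · exact Or.inr (by rw [h2, h1])
      · exact Or.inl (by rw [h2, h1, neg_neg])

/-- The relation `~` is decidable. -/
instance decRelNZ : DecidableRel ((· ≈ ·) : NZ p → NZ p → Prop) := fun v w =>
  inferInstanceAs (Decidable (w.1 = v.1 ∨ w.1 = -v.1))

/-- The fibre `(𝔽_p² ∖ 0)/±`. -/
abbrev V0 : Type := Quotient (pmSetoid p)

variable {p}

/-- Unfolding the relation. -/
theorem equiv_iff {v w : NZ p} : v ≈ w ↔ (w.1 = v.1 ∨ w.1 = -v.1) := Iff.rfl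

/-- A `2 × 2` matrix of determinant `1` fixing a nonzero row vector has trace `2`. [folklore] -/
theorem trace_eq_two_of_vecMul_eq {M : Matrix (Fin 2) (Fin 2) (ZMod p)} (hM : M.det = 1)
    {v : Fin 2 → ZMod p} (hv : v ≠ 0) (h : v ᵥ* M = v) : M.trace = 2 := by
  have h0 := congrFun h 0
  have h1 := congrFun h 1
  simp [Matrix.vecMul, dotProduct, Fin.sum_univ_two] at h0 h1
  rw [Matrix.det_fin_two] at hM
  rw [Matrix.trace_fin_two]
  have e0 : v 0 * (2 - (M 0 0 + M 1 1)) = 0 := by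
    linear_combination (M 1 1 - 1) * h0 - M 1 0 * h1 - v 0 * hM
  have e1 : v 1 * (2 - (M 0 0 + M 1 1)) = 0 := by
    linear_combination (M 0 0 - 1) * h1 - M 0 1 * h0 - v 1 * hM
  by_contra hne
  have hne' : (2 - (M 0 0 + M 1 1)) ≠ 0 := fun h' => hne (by linear_combination -h')
  have hv0 : v 0 = 0 := (mul_eq_zero.mp e0).resolve_right hne'
  have hv1 : v 1 = 0 := (mul_eq_zero.mp e1).resolve_right hne'
  exact hv (by ext i; fin_cases i <;> simp [hv0, hv1])

/-- A `2 × 2` matrix of determinant `1` negating a nonzero row vector has trace `-2`.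
[folklore] -/
theorem trace_eq_neg_two_of_vecMul_eq_neg {M : Matrix (Fin 2) (Fin 2) (ZMod p)}
    (hM : M.det = 1) {v : Fin 2 → ZMod p} (hv : v ≠ 0) (h : v ᵥ* M = -v) : M.trace = -2 := by
  have h0 := congrFun h 0
  have h1 := congrFun h 1
  simp [Matrix.vecMul, dotProduct, Fin.sum_univ_two] at h0 h1
  rw [Matrix.det_fin_two] at hM
  rw [Matrix.trace_fin_two]
  have e0 : v 0 * (2 + (M 0 0 + M 1 1)) = 0 := by
    linear_combination (M 1 1 + 1) * h0 - M 1 0 * h1 - v 0 * hM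
  have e1 : v 1 * (2 + (M 0 0 + M 1 1)) = 0 := by
    linear_combination (M 0 0 + 1) * h1 - M 0 1 * h0 - v 1 * hM
  by_contra hne
  have hne' : (2 + (M 0 0 + M 1 1)) ≠ 0 := fun h' => hne (by linear_combination h')
  have hv0 : v 0 = 0 := (mul_eq_zero.mp e0).resolve_right hne'
  have hv1 : v 1 = 0 := (mul_eq_zero.mp e1).resolve_right hne'
  exact hv (by ext i; fin_cases i <;> simp [hv0, hv1])

/-- A determinant-one matrix keeps nonzero row vectors nonzero. [folklore] -/
theorem vecMul_ne_zero {v : Fin 2 → ZMod p} (hv : v ≠ 0) {M : Matrix (Fin 2) (Fin 2) (ZMod p)}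
    (hM : M.det = 1) : v ᵥ* M ≠ 0 := by
  intro h
  apply hv
  calc v = v ᵥ* (M * M.adjugate) := by rw [Matrix.mul_adjugate, hM, one_smul, Matrix.vecMul_one]
    _ = (v ᵥ* M) ᵥ* M.adjugate := (Matrix.vecMul_vecMul _ _ _).symm
    _ = 0 := by rw [h, Matrix.zero_vecMul]

/-- Right action of a determinant-one matrix on nonzero vectors. -/
def actNZ (M : Matrix (Fin 2) (Fin 2) (ZMod p)) (hM : M.det = 1) (v : NZ p) : NZ p :=
  ⟨v.1 ᵥ* M, vecMul_ne_zero v.2 hM⟩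

/-- The induced right action on the fibre `V0`. -/
def actV (M : Matrix (Fin 2) (Fin 2) (ZMod p)) (hM : M.det = 1) : V0 p → V0 p :=
  Quotient.map (actNZ M hM) (by
    rintro v w (h | h)
    · exact Or.inl (by simp [actNZ, h])
    · exact Or.inr (by simp [actNZ, h, Matrix.neg_vecMul]))

/-- `actV` on a class. -/
theorem actV_mk (M : Matrix (Fin 2) (Fin 2) (ZMod p)) (hM : M.det = 1) (v : NZ p) :
    actV M hM ⟦v⟧ = ⟦actNZ M hM v⟧ := rfl

/-- `actV` depends only on the matrix. -/
theorem actV_congr {M N : Matrix (Fin 2) (Fin 2) (ZMod p)} (hM : M.det = 1) (hN : N.det = 1)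
    (h : M = N) (q : V0 p) : actV M hM q = actV N hN q := by
  subst h; rfl

/-- The identity matrix acts trivially. -/
theorem actV_one (h : (1 : Matrix (Fin 2) (Fin 2) (ZMod p)).det = 1) (q : V0 p) :
    actV 1 h q = q := by
  induction q using Quotient.inductionOn with
  | h v => rw [actV_mk]; exact Quotient.sound (Or.inl (by simp [actNZ]))

/-- The action is multiplicative: acting by `M` then `N` is acting by `M * N`. -/
theorem actV_actV (M N : Matrix (Fin 2) (Fin 2) (ZMod p)) (hM : M.det = 1) (hN : N.det = 1)
    (hMN : (M * N).det = 1) (q : V0 p) :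
    actV N hN (actV M hM q) = actV (M * N) hMN q := by
  induction q using Quotient.inductionOn with
  | h v =>
    rw [actV_mk, actV_mk, actV_mk]
    exact Quotient.sound (Or.inl (by simp [actNZ, Matrix.vecMul_vecMul]))

/-- `-1` acts trivially on the fibre. -/
theorem actV_neg_one (h : (-1 : Matrix (Fin 2) (Fin 2) (ZMod p)).det = 1) (q : V0 p) :
    actV (-1) h q = q := by
  induction q using Quotient.inductionOn with
  | h v => rw [actV_mk]; exact Quotient.sound (Or.inr (by simp [actNZ, Matrix.vecMul_neg]))

/-- A fixed point of the action of `M` forces `tr M = ± 2`. [folklore] -/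
theorem trace_of_actV_eq {M : Matrix (Fin 2) (Fin 2) (ZMod p)} {hM : M.det = 1} {q : V0 p}
    (h : actV M hM q = q) : M.trace = 2 ∨ M.trace = -2 := by
  induction q using Quotient.inductionOn with
  | h v =>
    rw [actV_mk] at h
    rcases Quotient.exact h with h' | h'
    · exact Or.inl (trace_eq_two_of_vecMul_eq hM v.2 (by simpa [actNZ] using h'.symm))
    · refine Or.inr (trace_eq_neg_two_of_vecMul_eq_neg hM v.2 ?_)
      simp only [actNZ] at h'
      rw [← neg_eq_iff_eq_neg.mpr h']

variable (p)

/-- Negation on nonzero vectors. -/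
def negNZ (v : NZ p) : NZ p := ⟨-v.1, neg_ne_zero.mpr v.2⟩

/-- The fibre is nonempty. -/
theorem card_V0_pos : 0 < Fintype.card (V0 p) := by
  rw [Fintype.card_pos_iff]
  refine ⟨⟦⟨![1, 0], ?_⟩⟧⟩
  intro h
  simpa using congrFun h 0

/-- `|V0 p| ≤ p²`. -/
theorem card_V0_le : Fintype.card (V0 p) ≤ p ^ 2 :=
  calc Fintype.card (V0 p) ≤ Fintype.card (NZ p) := Fintype.card_quotient_le _
    _ ≤ Fintype.card (Fin 2 → ZMod p) := Fintype.card_subtype_le _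
    _ = p ^ 2 := by simp [ZMod.card]

/-- There are `p² - 1` nonzero vectors. -/
theorem card_NZ : Fintype.card (NZ p) = p ^ 2 - 1 := by
  rw [Fintype.card_subtype_compl, Fintype.card_subtype_eq]
  simp [ZMod.card]

/-- Each class of `V0 p` has at most two representatives: `p² ≤ 2 |V0 p| + 1`. -/
theorem sq_le_two_mul_card_V0 : p ^ 2 ≤ 2 * Fintype.card (V0 p) + 1 := by
  classical
  have hfib : ∀ a ∈ (Finset.univ : Finset (NZ p)).image (fun v => (⟦v⟧ : V0 p)),
      ((Finset.univ : Finset (NZ p)).filter (fun x => (⟦x⟧ : V0 p) = a)).card ≤ 2 := by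
    intro a _
    induction a using Quotient.inductionOn with
    | h v =>
      calc _ ≤ ({v, negNZ p v} : Finset (NZ p)).card := by
            apply Finset.card_le_card
            intro x hx
            simp only [Finset.mem_filter, Finset.mem_univ, true_and] at hx
            rcases Quotient.exact hx with h | h
            · exact Finset.mem_insert.mpr (Or.inl (Subtype.ext h.symm))
            · refine Finset.mem_insert.mpr (Or.inr (Finset.mem_singleton.mpr (Subtype.ext ?_)))
              simp [negNZ, h]
        _ ≤ 2 := Finset.card_le_two
  have h1 := Finset.card_le_mul_card_image (Finset.univ : Finset (NZ p)) 2 hfib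
  have h2 : ((Finset.univ : Finset (NZ p)).image (fun v => (⟦v⟧ : V0 p))).card ≤
      Fintype.card (V0 p) := Finset.card_le_univ _
  rw [Finset.card_univ, card_NZ] at h1
  have h3 : 1 ≤ p ^ 2 := Nat.one_le_pow _ _ (Fact.out : p.Prime).pos
  omega

/-- `2 ≠ 0` in `ZMod q` once `q ≥ 3`. [folklore] -/
theorem two_ne_zero_of_three_le {q : ℕ} (h3 : 3 ≤ q) : (2 : ZMod q) ≠ 0 := by
  intro h
  have hdvd : q ∣ 2 := by
    rw [← ZMod.natCast_eq_zero_iff]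
    exact_mod_cast h
  have := Nat.le_of_dvd (by norm_num) hdvd
  omega

/-- Registered stub `stub_fibreTraceDichotomy` of crux `stmt-MatrixMultiplication-10883` (this file's
ticket): a determinant-one `2 × 2` matrix over `ZMod p` with a nonzero row vector `v`, `v M = ± v`, has
trace `± 2`. [folklore] -/
theorem stub_fibreTraceDichotomy : ∀ (p : ℕ) [Fact p.Prime] (M : Matrix (Fin 2) (Fin 2) (ZMod p)), M.det = 1 → ∀ v : Fin 2 → ZMod p, v ≠ 0 → (Matrix.vecMul v M = v ∨ Matrix.vecMul v M = -v) → M.trace = 2 ∨ M.trace = -2 :=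
  fun _ _ _ hM _ hv h => h.elim (fun h => Or.inl (trace_eq_two_of_vecMul_eq hM hv h))
    (fun h => Or.inr (trace_eq_neg_two_of_vecMul_eq_neg hM hv h))

end Model

end PoorHost

end Summit.MatrixMultiplication.MatrixMultiplication.Theorems.HyperoctahedralThreshold
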